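import Summits.NavierStokesRegularity.NavierStokesRegularity.Theorems.SoloRefuteTsionskiy2025Gauss

/-!
# C15 `Tsionskiy2025` — kernel refutation of Theorem 6.1, (6.15)/(6.16) p. 135
# («|B̿·u⃗₀| < |u⃗₀|»): part 2/3, the first failing step `Step_2`

Cell `ns-claims` (D-0090 NS-CLAIMS SWEEP), claim C15; refuter `ns-claims-refuter-6`; referee
`ns-claims-ref-4`. Text of record: A. Tsionskiy, M. Tsionskiy, Int. J. Math. Anal. 19 (2025) no. 3,
117–149 [TsionskiyTsionskiy2025]; typed skeleton `Literature.Claims.NS.Tsionskiy2025` (p462200, rev 2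
p463109), whose `cutoff`, `symbB`, `symbE`, `mulOp`, `opB`, `opE`, `supNorm`, `vecNorm`, `InS` are used
verbatim (`opB_eq`: for the even multiplier (6.8) the sign in `mulOp` drops, `mulOp_eq_of_even`).

FIRST FAILING STEP (skeleton index order, TYPING-HYGIENE 11): `Step_2` = Theorem 6.1, (6.16) p. 135
«|B̿·u⃗₀| < |u⃗₀|, u⃗₀ ∈ →TS», `B = F⁻¹[e^{−ν|γ|²t} δ(γ) F·]`. Class: false lemma (countermodel). Since
`δ(0) = 0` the kernel of `B` has zero mean: `B` annihilates the wide part of a profile and keeps the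
narrow part. For the two-scale Schwartz function `w(x) = e^{−(ε³/144)|x|²} − 2e^{−315ε³|x|²}`:
`|w| ≤ 1 = |w(0)|`, while `(Bw)(0) = ∫ m_B(2πξ) ŵ(ξ) dξ ≤ 1/10 − 2·(17/20) = −8/5` whenever
`ν t ε³ ≤ 1/63000` (`Bop_wfun_zero_le`); hence `‖Bw‖₀ ≥ 8/5 > 1 ≥ ‖w‖₀` for EVERY `ν ≥ 0`, `ε > 0`,
`t > 0` with `ν t ε³ ≤ 1/63000` (`eq615_fails`) — in particular at `ν = 1`, `ε = e^{−2}`, `t = e^{−6}`,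
inside the printed example set `ε = e^{−q₁}`, `δt = e^{−q₃}`, `qᵢ = 2, 3, 4, …` (p. 122 l. 30,
p. 145 l. 28) (`not_Eq615`; `not_Step_2` with `u⃗₀ = (w, w, w)`, norm (3.3) = sum of the component
sup-norms). `Step_1` (§5 equivalence) is not decided here (plausible; no cheap attack found).

Load-bearing (MAP-SCHEMA §1b): (6.16) is consumed verbatim by (7.7) p. 144 («Using inequalities (6.59)
for operator S̿_δt, (6.33) for operator E̿ and (6.16) for operator B̿»), hence by the a-priori estimate
(7.11) = `Step_9`, by the printed proof of Thm 8.2 ((8.4) p. 146, `Step_11`) and by §8's preamble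
p. 145 before Thm 8.1 (`Step_10`). Repair census: the honest constant is `‖B‖_{∞→∞} = ‖F⁻¹m_B‖_{L¹}
≥ 8/5` (not `< 1`); with it and `‖E‖_{∞→∞} ≥ 9/10` (part 3) the inequality (7.7) reads
`|u⃗| ≤ δt|(u⃗·∇)u⃗| + C_E|u⃗| + C_B|u⃗₀|`, `C_E ≥ 9/10`, `C_B ≥ 8/5`, from which (7.11) `|u⃗| ≤ |u⃗₀|` does
not follow: the contraction mechanism of §7 does not survive the repair.

Closed terms; axioms `propext`, `Classical.choice`, `Quot.sound`. Part 3 (`…OpE.lean`) refutes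
`Step_3` = Theorem 6.2 the same way.

WHAT THIS IS NOT: not a claim about NS regularity or blow-up; not a claim about any author beyond the
typed locator.
-/

-- The summit's canonical theorem namespace repeats the summit name (single-conjunct summit).
set_option linter.dupNamespace false

noncomputable section

open MeasureTheory Real
open scoped RealInnerProductSpace FourierTransform ContDiff SchwartzMap
open Literature.Claims.NS.Tsionskiy2025

namespace Summit.NavierStokesRegularity.NavierStokesRegularity.Theorems.Tsionskiy2025

/-! ## Part B — the Fourier side (Mathlib normalisation)

`mulOpEv m u = Re 𝓕⁻[ξ ↦ m(2πξ) · 𝓕u(ξ)]` is the skeleton's `mulOpEv m u` for an EVEN multiplier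
(`Literature.Claims.NS.Tsionskiy2025.mulOp_eq_of_even`); `multB` is the skeleton's `symbB` with the
exponent written `-(νt)‖γ‖²` (`symbB_eq_multB`); `symbE`, `cutoff`, `supNorm`, `vecNorm`, `InS` are the
skeleton's own. -/

/-- `u ↦ Re F⁻¹[m(2πξ) · F u]`: the skeleton's `mulOpEv` with the sign of an even multiplier dropped. -/
def mulOpEv (m : E3 → ℝ) (u : E3 → ℝ) (x : E3) : ℝ :=
  (𝓕⁻ (fun ξ : E3 => ((m ((2 * π) • ξ) : ℂ) * 𝓕 (fun y : E3 => (u y : ℂ)) ξ)) x).re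

/-- (6.7) p. 133: the multiplier of `B`, `e^{-νt|γ|²} δ(γ)` (= `symbB ν t ε`, see `symbB_eq_multB`). -/
def multB (ν t ε : ℝ) (γ : E3) : ℝ := Real.exp (-(ν * t) * ‖γ‖ ^ 2) * cutoff ε γ

/-- `B` on a scalar, sign-free form (= `opB`, see `opB_eq`). -/
def Bop (ν t ε : ℝ) (u : E3 → ℝ) : E3 → ℝ := mulOpEv (multB ν t ε) u

/-- The real Gaussian `x ↦ e^{-a‖x‖²}`. -/
def gfun (a : ℝ) (y : E3) : ℝ := Real.exp (-a * ‖y‖ ^ 2)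

open Complex in
/-- Fourier transform of the Gaussian in Mathlib's normalisation: `𝓕[e^{-a‖·‖²}] = Ĝ_a`. -/
lemma fourier_gfun {a : ℝ} (ha : 0 < a) (ξ : E3) :
    𝓕 (fun y : E3 => ((gfun a y : ℝ) : ℂ)) ξ = ((ghat a ξ : ℝ) : ℂ) := by
  have hb : 0 < (a : ℂ).re := by simpa using ha
  have hfun : (fun y : E3 => ((gfun a y : ℝ) : ℂ)) = fun y : E3 => cexp (-(a : ℂ) * ‖y‖ ^ 2) := by
    funext y; simp only [gfun]; push_cast; ring_nf
  rw [hfun, fourier_gaussian_innerProductSpace hb, finrank_E3, ghat, Complex.ofReal_mul,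
    Complex.ofReal_cpow (by positivity : 0 ≤ π / a), Complex.ofReal_exp]
  congr 1
  · push_cast; ring_nf
  · congr 1; push_cast; ring

/-- `𝓕⁻ F (0) = ∫ F`. -/
lemma fourierInv_apply_zero (F : E3 → ℂ) : 𝓕⁻ F 0 = ∫ ξ, F ξ := by
  rw [Real.fourierInv_eq]; simp

/-- `‖𝓕⁻ F (x)‖ ≤ ∫ ‖F‖` (no integrability needed). -/
lemma norm_fourierInv_le (F : E3 → ℂ) (x : E3) : ‖𝓕⁻ F x‖ ≤ ∫ ξ, ‖F ξ‖ := by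
  rw [Real.fourierInv_eq]
  refine (norm_integral_le_integral_norm _).trans (le_of_eq ?_)
  simp_rw [Circle.norm_smul]

/-- The multiplier operator is bounded pointwise by a constant (so its `⨆` is not junk). -/
lemma abs_mulOp_le (m u : E3 → ℝ) (x : E3) :
    |mulOpEv m u x| ≤ ∫ ξ : E3, ‖((m ((2 * π) • ξ) : ℂ) * 𝓕 (fun y : E3 => (u y : ℂ)) ξ)‖ :=
  (Complex.abs_re_le_norm _).trans (norm_fourierInv_le _ x)

/-- The range of `|mulOpEv m u|` is bounded above (so `supNorm` of it is not a junk value). -/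
lemma bddAbove_mulOp (m u : E3 → ℝ) : BddAbove (Set.range fun x => |mulOpEv m u x|) :=
  ⟨_, by rintro _ ⟨x, rfl⟩; exact abs_mulOp_le m u x⟩

/-- `|mulOpEv m u (x)| ≤ ‖mulOpEv m u‖₀`. -/
lemma abs_mulOp_le_supNorm (m u : E3 → ℝ) (x : E3) : |mulOpEv m u x| ≤ supNorm (mulOpEv m u) :=
  abs_le_supNorm (bddAbove_mulOp m u) x

/-- Fourier transform of the two-scale function `e^{-p‖·‖²} - 2 e^{-q‖·‖²}`. -/
lemma fourier_twoScale {p q : ℝ} (hp : 0 < p) (hq : 0 < q) (ξ : E3) :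
    𝓕 (fun y : E3 => ((gfun p y - 2 * gfun q y : ℝ) : ℂ)) ξ
      = ((ghat p ξ - 2 * ghat q ξ : ℝ) : ℂ) := by
  have hip : Integrable (fun v : E3 => 𝐞 (-⟪v, ξ⟫) • ((gfun p v : ℝ) : ℂ)) :=
    (Real.fourierIntegral_convergent_iff ξ).2 (integrable_gauss hp).ofReal
  have hiq : Integrable (fun v : E3 => 𝐞 (-⟪v, ξ⟫) • ((gfun q v : ℝ) : ℂ)) :=
    (Real.fourierIntegral_convergent_iff ξ).2 (integrable_gauss hq).ofReal
  have hsplit : (fun v : E3 => 𝐞 (-⟪v, ξ⟫) • (((gfun p v - 2 * gfun q v : ℝ)) : ℂ))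
      = fun v => 𝐞 (-⟪v, ξ⟫) • ((gfun p v : ℝ) : ℂ) - (2 : ℂ) * (𝐞 (-⟪v, ξ⟫) • ((gfun q v : ℝ) : ℂ)) := by
    funext v
    simp only [Circle.smul_def]
    push_cast
    ring
  rw [Real.fourier_eq, hsplit, integral_sub hip (hiq.const_mul 2), integral_const_mul,
    ← Real.fourier_eq, ← Real.fourier_eq, fourier_gfun hp, fourier_gfun hq]
  push_cast
  ring

/-- Value at `0` of the multiplier operator on the two-scale function. -/
lemma mulOp_twoScale_zero {p q : ℝ} (hp : 0 < p) (hq : 0 < q) {m : E3 → ℝ}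
    (hm : Measurable (fun ξ : E3 => m ((2 * π) • ξ))) (hm1 : ∀ γ, |m γ| ≤ 1) :
    mulOpEv m (fun y => gfun p y - 2 * gfun q y) 0
      = (∫ ξ : E3, m ((2 * π) • ξ) * ghat p ξ) - 2 * ∫ ξ : E3, m ((2 * π) • ξ) * ghat q ξ := by
  unfold mulOpEv
  have h1 : (fun ξ : E3 => ((m ((2 * π) • ξ) : ℝ) : ℂ)
        * 𝓕 (fun y : E3 => ((gfun p y - 2 * gfun q y : ℝ) : ℂ)) ξ)
      = fun ξ => (((m ((2 * π) • ξ) * ghat p ξ - 2 * (m ((2 * π) • ξ) * ghat q ξ) : ℝ)) : ℂ) := by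
    funext ξ; rw [fourier_twoScale hp hq]; push_cast; ring
  have hIp : Integrable (fun ξ : E3 => m ((2 * π) • ξ) * ghat p ξ) :=
    (integrable_ghat hp).bdd_mul (c := 1) hm.aestronglyMeasurable (ae_of_all _ fun ξ => hm1 _)
  have hIq : Integrable (fun ξ : E3 => m ((2 * π) • ξ) * ghat q ξ) :=
    (integrable_ghat hq).bdd_mul (c := 1) hm.aestronglyMeasurable (ae_of_all _ fun ξ => hm1 _)
  rw [h1, fourierInv_apply_zero, integral_complex_ofReal, Complex.ofReal_re,
    integral_sub hIp (hIq.const_mul 2), integral_const_mul]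

/-- `∫ δ(2πξ) Ĝ_{ε³/144}(ξ) dξ ≤ 1/10`. -/
lemma avg_cutoff_wide_le {ε : ℝ} (hε : 0 < ε) :
    ∫ ξ : E3, cutoff ε ((2 * π) • ξ) * ghat (ε ^ 3 / 144) ξ ≤ 1 / 10 := by
  have ha : 0 < ε ^ 3 / 144 := by positivity
  have hr : 0 < Real.sqrt (ε ^ 3 / 3) := Real.sqrt_pos.mpr (by positivity)
  have h := avg_cutoff_le hε ha hr
  have hr2 : Real.sqrt (ε ^ 3 / 3) ^ 2 = ε ^ 3 / 3 := Real.sq_sqrt (by positivity)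
  rw [hr2] at h
  have e1 : -(ε ^ 3) / (ε ^ 3 / 3) = -3 := by field_simp
  have e2 : -(3 * (ε ^ 3 / 3)) / (16 * (ε ^ 3 / 144)) = -9 := by field_simp; ring
  rw [e1, e2] at h
  linarith [exp_neg_three_bounds.1]

/-! ## Part C — the `B` witness: `w = e^{-(ε³/144)‖x‖²} - 2 e^{-315ε³‖x‖²}` -/

/-- The two-scale function. -/
def wfun (ε : ℝ) (y : E3) : ℝ := gfun (ε ^ 3 / 144) y - 2 * gfun (315 * ε ^ 3) y

/-- `w(0) = -1`. -/
lemma wfun_zero (ε : ℝ) : wfun ε 0 = -1 := by simp [wfun, gfun]; norm_num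

/-- `|w| ≤ 1` pointwise (the narrow Gaussian is below the wide one). -/
lemma abs_wfun_le_one {ε : ℝ} (hε : 0 < ε) (y : E3) : |wfun ε y| ≤ 1 := by
  have hA1 : gfun (ε ^ 3 / 144) y ≤ 1 := by
    rw [gfun, Real.exp_le_one_iff]; nlinarith [norm_nonneg y, pow_pos hε 3]
  have hB0 : 0 < gfun (315 * ε ^ 3) y := Real.exp_pos _
  have hBA : gfun (315 * ε ^ 3) y ≤ gfun (ε ^ 3 / 144) y := by
    rw [gfun, gfun, Real.exp_le_exp]; nlinarith [norm_nonneg y, pow_pos hε 3, sq_nonneg ‖y‖]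
  rw [wfun, abs_le]; constructor <;> linarith

/-- `0 ≤ m_B` ((6.14) p. 135, lower half). -/
lemma multB_nonneg (ν t ε : ℝ) (γ : E3) : 0 ≤ multB ν t ε γ :=
  mul_nonneg (Real.exp_pos _).le (cutoff_nonneg ε γ)

/-- `m_B ≤ δ` for `νt ≥ 0`. -/
lemma multB_le_cutoff {ν t ε : ℝ} (hνt : 0 ≤ ν * t) (γ : E3) : multB ν t ε γ ≤ cutoff ε γ := by
  have h1 : Real.exp (-(ν * t) * ‖γ‖ ^ 2) ≤ 1 := by
    rw [Real.exp_le_one_iff]; nlinarith [norm_nonneg γ]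
  have := cutoff_nonneg ε γ
  calc multB ν t ε γ = Real.exp (-(ν * t) * ‖γ‖ ^ 2) * cutoff ε γ := rfl
    _ ≤ 1 * cutoff ε γ := mul_le_mul_of_nonneg_right h1 this
    _ = cutoff ε γ := one_mul _

/-- `|m_B| ≤ 1` ((6.14) p. 135). -/
lemma abs_multB_le_one {ν t ε : ℝ} (hνt : 0 ≤ ν * t) (hε : 0 ≤ ε) (γ : E3) : |multB ν t ε γ| ≤ 1 := by
  rw [abs_of_nonneg (multB_nonneg ν t ε γ)]
  exact (multB_le_cutoff hνt γ).trans (cutoff_le_one hε γ)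

/-- `ξ ↦ m_B(2πξ)` is measurable. -/
lemma measurable_multB_smul (ν t ε : ℝ) : Measurable (fun ξ : E3 => multB ν t ε ((2 * π) • ξ)) := by
  simp only [multB]
  exact measurable_heat_mul_cutoff_smul ε (ν * t)

/-- Wide part: `∫ m_B(2πξ) Ĝ_{ε³/144} ≤ 1/10`. -/
lemma avg_multB_wide_le {ν t ε : ℝ} (hνt : 0 ≤ ν * t) (hε : 0 < ε) :
    ∫ ξ : E3, multB ν t ε ((2 * π) • ξ) * ghat (ε ^ 3 / 144) ξ ≤ 1 / 10 := by
  have ha : 0 < ε ^ 3 / 144 := by positivity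
  refine le_trans ?_ (avg_cutoff_wide_le hε)
  refine integral_mono ?_ (integrable_cutoff_smul_mul_ghat hε.le ha) fun ξ => ?_
  · exact (integrable_ghat ha).bdd_mul (c := 1) (measurable_multB_smul ν t ε).aestronglyMeasurable
      (ae_of_all _ fun ξ => abs_multB_le_one hνt hε.le _)
  · exact mul_le_mul_of_nonneg_right (multB_le_cutoff hνt _) (ghat_nonneg ha ξ)

/-- Narrow part: `∫ m_B(2πξ) Ĝ_{315ε³} ≥ 17/20` when `ν t ε³ ≤ 1/63000`. -/
lemma avg_multB_narrow_ge {ν t ε : ℝ} (hνt : 0 ≤ ν * t) (hε : 0 < ε)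
    (hsmall : ν * t * ε ^ 3 ≤ 1 / 63000) :
    17 / 20 ≤ ∫ ξ : E3, multB ν t ε ((2 * π) • ξ) * ghat (315 * ε ^ 3) ξ := by
  have hq : 0 < 315 * ε ^ 3 := by positivity
  have hr : 0 < Real.sqrt (20 * ε ^ 3) := Real.sqrt_pos.mpr (by positivity)
  have hκ : (0:ℝ) ≤ 1 / (20 * ε ^ 3) := by positivity
  have h := avg_multB_ge (s := ν * t) hε hνt hq hr hκ
  have hr2 : Real.sqrt (20 * ε ^ 3) ^ 2 = 20 * ε ^ 3 := Real.sq_sqrt (by positivity)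
  rw [hr2] at h
  have e1 : -(ε ^ 3) / (20 * ε ^ 3) = -(1 / 20) := by field_simp
  have e2 : 1 / (20 * ε ^ 3) * (20 * ε ^ 3) = 1 := by field_simp
  have e3 : 1 / (1 + 4 * (1 / (20 * ε ^ 3)) * (315 * ε ^ 3)) = 1 / 64 := by field_simp; ring
  rw [e1, e2, e3] at h
  -- the multiplier integrand matches
  have hfun : (fun ξ : E3 => (Real.exp (-(ν * t) * ‖(2 * π) • ξ‖ ^ 2) * cutoff ε ((2 * π) • ξ))
        * ghat (315 * ε ^ 3) ξ) = fun ξ => multB ν t ε ((2 * π) • ξ) * ghat (315 * ε ^ 3) ξ := by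
    funext ξ; rfl
  rw [hfun] at h
  -- numeric pieces
  have hx0 : 0 < 1 / (1 + 4 * (ν * t) * (315 * ε ^ 3)) := by positivity
  have hx1 : 1 / (1 + 4 * (ν * t) * (315 * ε ^ 3)) ≤ 1 := by
    rw [div_le_one (by positivity)]; nlinarith [pow_pos hε 3]
  have hxlow : (50:ℝ) / 51 ≤ 1 / (1 + 4 * (ν * t) * (315 * ε ^ 3)) := by
    rw [div_le_div_iff₀ (by norm_num) (by positivity)]; nlinarith
  have hheat : (50 / 51 : ℝ) ^ 2 ≤ (1 / (1 + 4 * (ν * t) * (315 * ε ^ 3))) ^ ((3:ℝ) / 2) := by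
    calc (50 / 51 : ℝ) ^ 2 ≤ (1 / (1 + 4 * (ν * t) * (315 * ε ^ 3))) ^ 2 :=
          pow_le_pow_left₀ (by norm_num) hxlow 2
      _ = (1 / (1 + 4 * (ν * t) * (315 * ε ^ 3))) ^ (2:ℝ) := (Real.rpow_two _).symm
      _ ≤ (1 / (1 + 4 * (ν * t) * (315 * ε ^ 3))) ^ ((3:ℝ) / 2) :=
          Real.rpow_le_rpow_of_exponent_ge hx0 hx1 (by norm_num)
  have hcut : 1 - Real.exp (-(1 / 20)) ≤ (1:ℝ) / 20 := by
    have := Real.add_one_le_exp (-(1 / 20 : ℝ)); linarith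
  have h64 : (1 / 64 : ℝ) ^ ((3:ℝ) / 2) ≤ 1 / 64 := by
    calc (1 / 64 : ℝ) ^ ((3:ℝ) / 2) ≤ (1 / 64 : ℝ) ^ (1:ℝ) :=
          Real.rpow_le_rpow_of_exponent_ge (by norm_num) (by norm_num) (by norm_num)
      _ = 1 / 64 := Real.rpow_one _
  have hexp : Real.exp 1 * (1 / 64 : ℝ) ^ ((3:ℝ) / 2) ≤ 2.72 * (1 / 64) :=
    mul_le_mul exp_one_lt.le h64 (by positivity) (by norm_num)
  linarith

/-- `(B w)(0) ≤ -8/5` for the two-scale witness, whenever `ν t ε³ ≤ 1/63000`. -/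
lemma Bop_wfun_zero_le {ν t ε : ℝ} (hνt : 0 ≤ ν * t) (hε : 0 < ε)
    (hsmall : ν * t * ε ^ 3 ≤ 1 / 63000) :
    Bop ν t ε (wfun ε) 0 ≤ -(8 / 5) := by
  have hp : 0 < ε ^ 3 / 144 := by positivity
  have hq : 0 < 315 * ε ^ 3 := by positivity
  rw [Bop, show wfun ε = fun y => gfun (ε ^ 3 / 144) y - 2 * gfun (315 * ε ^ 3) y from rfl,
    mulOp_twoScale_zero hp hq (measurable_multB_smul ν t ε) (abs_multB_le_one hνt hε.le)]
  linarith [avg_multB_wide_le hνt hε, avg_multB_narrow_ge hνt hε hsmall]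

/-- `|(Bw)(0)| ≥ 8/5` whenever `ν t ε³ ≤ 1/63000`. -/
lemma abs_Bop_wfun_zero_ge {ν t ε : ℝ} (hνt : 0 ≤ ν * t) (hε : 0 < ε)
    (hsmall : ν * t * ε ^ 3 ≤ 1 / 63000) :
    8 / 5 ≤ |Bop ν t ε (wfun ε) 0| := by
  have := Bop_wfun_zero_le hνt hε hsmall
  rw [abs_of_nonpos (by linarith)]; linarith

/-! ## Part D — bridges to the skeleton's operators, Schwartz packaging, and the refutations -/

/-- `m_B` is even ((6.8) p. 134). -/
lemma multB_even (ν t ε : ℝ) (γ : E3) : multB ν t ε (-γ) = multB ν t ε γ := by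
  simp [multB, cutoff, norm_neg, neg_eq_zero]

/-- The skeleton's multiplier (6.7) is `multB` (exponent `-(ν|γ|²t) = -(νt)|γ|²`). -/
lemma symbB_eq_multB (ν t ε : ℝ) : symbB ν t ε = multB ν t ε := by
  funext γ
  simp only [symbB, multB]
  rw [show -(ν * ‖γ‖ ^ 2 * t) = -(ν * t) * ‖γ‖ ^ 2 by ring]

/-- The skeleton's `opB` (6.4)/(6.6)–(6.7) p. 133 is `Bop` (even multiplier, `mulOp_eq_of_even`).
[cite: TsionskiyTsionskiy2025, (6.6)–(6.8) pp. 133–134] -/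
lemma opB_eq (ν t ε : ℝ) (φ : E3 → ℝ) : opB ν t ε φ = Bop ν t ε φ := by
  funext x
  rw [opB, symbB_eq_multB, mulOp_eq_of_even (multB_even ν t ε)]
  rfl

/-- The norm (3.3)/(6.2) of a field with three equal components is `3 ×` the component's sup-norm.
[cite: TsionskiyTsionskiy2025, (3.3) p. 120] -/
lemma vecNorm_const (φ : E3 → ℝ) : vecNorm (fun _ : Fin 3 => φ) = 3 * supNorm φ := by
  simp [vecNorm, Finset.sum_const, Finset.card_univ, Fintype.card_fin, nsmul_eq_mul]

/-- Schwartz maps have Fefferman-(4) decay `HasRapidSpatialDecay` (the skeleton's `S`, p. 120). -/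
lemma hasRapidSpatialDecay_schwartz (f : 𝓢(E3, ℝ)) :
    Literature.Analysis.FluidPDE.HasRapidSpatialDecay (⇑f) := fun n K =>
  ⟨2 ^ K * (Finset.Iic (K, n)).sup (fun m => SchwartzMap.seminorm ℝ m.1 m.2) f,
    fun x => SchwartzMap.one_add_le_sup_seminorm_apply (𝕜 := ℝ) (m := (K, n)) le_rfl le_rfl f x⟩

/-- Every Schwartz map is in the paper's class `S` (`InS`). -/
lemma inS_schwartz (f : 𝓢(E3, ℝ)) : InS (⇑f) := ⟨f.smooth ⊤, hasRapidSpatialDecay_schwartz f⟩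

/-- `w` is (the coercion of) the Schwartz map `G_{ε³/144} - 2 • G_{315ε³}`. -/
lemma wfun_eq_coe {ε : ℝ} (hε : 0 < ε) :
    wfun ε = ⇑(Literature.Analysis.FunctionSpaces.realGaussianSchwartz E3 (ε ^ 3 / 144)
      - (2:ℝ) • Literature.Analysis.FunctionSpaces.realGaussianSchwartz E3 (315 * ε ^ 3)) := by
  have hp : 0 < ε ^ 3 / 144 := by positivity
  have hq : 0 < 315 * ε ^ 3 := by positivity
  funext y
  simp [wfun, gfun, Literature.Analysis.FunctionSpaces.realGaussianSchwartz_apply hp,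
    Literature.Analysis.FunctionSpaces.realGaussianSchwartz_apply hq]

/-- The two-scale function `w` is in the paper's class `S`. -/
lemma inS_wfun {ε : ℝ} (hε : 0 < ε) : InS (wfun ε) := by
  rw [wfun_eq_coe hε]; exact inS_schwartz _

/-! ### Numeric side conditions of the instance `ν = 1`, `ε = e^{-2}`, `t = e^{-6}`

The instance lies in the printed parameter set: «For example ε = e^{−q₁}, q₁ = 2, 3, 4, …» (p. 122
l. 30), «For example δt = e^{−q₃}, q₃ = 2, 3, 4, …» (p. 145 l. 28), `ν > 0`. -/

/-- `e^{-6} ≤ e^{-2}`: the instance time `t = e^{-6}` is admissible. -/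
lemma exp_neg_six_le_exp_neg_two : Real.exp (-6) ≤ Real.exp (-2) :=
  Real.exp_le_exp.mpr (by norm_num)

/-- `1 · e^{-6} · (e^{-2})³ = e^{-12} ≤ 1/63000`: the instance satisfies the smallness condition. -/
lemma smallness_instance : (1:ℝ) * Real.exp (-6) * Real.exp (-2) ^ 3 ≤ 1 / 63000 := by
  have h : (1:ℝ) * Real.exp (-6) * Real.exp (-2) ^ 3 = (Real.exp (-3) ^ 2) ^ 2 := by
    rw [← pow_mul, ← Real.exp_nat_mul, ← Real.exp_nat_mul, one_mul, ← Real.exp_add]; norm_num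
  rw [h]
  have h1 := exp_neg_three_bounds.2
  have h0 : 0 ≤ Real.exp (-3) ^ 2 := sq_nonneg _
  calc (Real.exp (-3) ^ 2) ^ 2 ≤ (1 / 400) ^ 2 := pow_le_pow_left₀ h0 h1 2
    _ ≤ 1 / 63000 := by norm_num

/-! ### Theorem 6.1: (6.15)/(6.16) p. 135 -/

/-- **(6.15) fails**: for every `ν ≥ 0`, `ε > 0`, `t > 0` with `ν t ε³ ≤ 1/63000` the two-scale Schwartz
function `w` has `‖w‖₀ ≤ 1 < 8/5 ≤ |(Bw)(0)| ≤ ‖Bw‖₀`. [cite: TsionskiyTsionskiy2025, Thm 6.1 (6.15) p.135] -/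
theorem eq615_fails {ν ε t : ℝ} (hν : 0 ≤ ν) (hε : 0 < ε) (ht : 0 < t)
    (hsmall : ν * t * ε ^ 3 ≤ 1 / 63000) :
    supNorm (wfun ε) < supNorm (opB ν t ε (wfun ε)) := by
  have hνt : 0 ≤ ν * t := mul_nonneg hν ht.le
  have h1 : supNorm (wfun ε) ≤ 1 := supNorm_le (abs_wfun_le_one hε)
  have h2 : 8 / 5 ≤ |opB ν t ε (wfun ε) 0| := by
    rw [opB_eq]; exact abs_Bop_wfun_zero_ge hνt hε hsmall
  have h3 : |opB ν t ε (wfun ε) 0| ≤ supNorm (opB ν t ε (wfun ε)) := by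
    rw [opB_eq]; exact abs_mulOp_le_supNorm _ _ 0
  linarith

/-- **`¬ Eq615`** — the scalar form (6.15) p. 135 of Theorem 6.1 is false: instance `ν = 1`, `ε = e^{−2}`,
`t = e^{−6}`, `u⁰ᵢ = w`. [cite: TsionskiyTsionskiy2025, Thm 6.1 (6.15) p.135] -/
theorem not_Eq615 : ¬ Eq615 := by
  intro h
  have hε : (0:ℝ) < Real.exp (-2) := Real.exp_pos _
  have hlt := h 1 zero_le_one (Real.exp (-2)) hε le_rfl (Real.exp (-6)) (Real.exp_pos _)
    exp_neg_six_le_exp_neg_two (wfun (Real.exp (-2))) (inS_wfun hε) ⟨0, by rw [wfun_zero]; norm_num⟩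
  exact absurd hlt (not_lt.mpr (eq615_fails zero_le_one hε (Real.exp_pos _) smallness_instance).le)

/-- The vector instance `u⃗ = (w, w, w)` of (6.16): `|B̿u⃗| = 3‖Bw‖₀ > 3‖w‖₀ = |u⃗|`.
[cite: TsionskiyTsionskiy2025, Thm 6.1 (6.16) p.135] -/
theorem step2_fails {ν ε t : ℝ} (hν : 0 ≤ ν) (hε : 0 < ε) (ht : 0 < t)
    (hsmall : ν * t * ε ^ 3 ≤ 1 / 63000) :
    ¬ vecNorm (fun i => opB ν t ε ((fun _ : Fin 3 => wfun ε) i)) < vecNorm (fun _ : Fin 3 => wfun ε) := by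
  intro hlt
  have := eq615_fails hν hε ht hsmall
  simp only [vecNorm_const] at hlt
  linarith

/-- **`¬ Step_2`** — Theorem 6.1, (6.16) p. 135 «|B̿·u⃗₀| < |u⃗₀|, u⃗₀ ∈ →TS» is false: instance `ν = 1`,
`ε = e^{−2}`, `t = e^{−6}`, `u⃗₀ = (w, w, w)` with `w(x) = e^{−(ε³/144)|x|²} − 2e^{−315ε³|x|²}`.
Class: false lemma (countermodel). [cite: TsionskiyTsionskiy2025, Thm 6.1 (6.16) p.135] -/
theorem not_Step_2 : ¬ Step_2 := by
  intro h
  have hε : (0:ℝ) < Real.exp (-2) := Real.exp_pos _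
  exact step2_fails zero_le_one hε (Real.exp_pos (-6)) smallness_instance
    (h 1 zero_le_one (Real.exp (-2)) hε le_rfl (Real.exp (-6)) (Real.exp_pos _) exp_neg_six_le_exp_neg_two
      (fun _ => wfun (Real.exp (-2))) (fun _ => inS_wfun hε) ⟨0, 0, by rw [wfun_zero]; norm_num⟩)
end Summit.NavierStokesRegularity.NavierStokesRegularity.Theorems.Tsionskiy2025
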